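import Literature.NumberTheory.PAdicHodge.BdRPlusLogTeich
import Literature.NumberTheory.PAdicHodge.AinfGaloisContinuity
import HarnessLib

/-!
# `p`-adic continuity of `Γ_F` on the Teichmüller logarithms: `σM − M ∈ p^N X⁰_k + Fil^k` on an open subgroup

Topic `Literature/NumberTheory/PAdicHodge`; namespace `Literature.NumberTheory.PAdicHodge.GaloisContinuity`. THEOREMS ONLY (no definition,
no named fact, no instance, no `sorry`). Sequel of `BdRPlusLogTeich` (`X⁰_k`: logarithms `log[y] mod Fil^k`, `y ∈ 𝒪_{ℂ_F}♭`, `y₀ = 1`,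
a `ℤ_p[Γ_F]`-module) and of `AinfGaloisContinuity` (continuity of `Γ_F` on the tilt in the group variable: finitely many coefficients of
`τ y` and `y` in `𝒪_{ℂ_F}/p` agree for `τ` in an open subgroup).

The Teichmüller logarithm `M = log[y]` is NOT locally constant in `σ` for the `ξ`-adic topology of `B_dR⁺` (`σM − M = a(σ) t` already for
`y = ũ`), but it is continuous for the `p`-ADIC structure of `X⁰_k`:

* §1 (tilt) `tilt_exists_pow_eq_of_forall_coeff_eq_one` — if the coefficients `z_0, …, z_N` of `z ∈ 𝒪_{ℂ_F}♭` are `1` then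
  **`z = w^{p^N}` with `w₀ = 1`** (`w = φ^{-N} z`, perfectness); `exists_openSubgroup_galTilt_eq_mul_pow` — for `y₀ = 1` and every `N`,
  **`τ y = y · w_τ^{p^N}` with `(w_τ)₀ = 1` for all `τ` in an open subgroup** (coefficient agreement `AinfGaloisContinuity` + the unit
  `y⁻¹ = y^{(-1)}`, `TiltPowPadicInt`).
* §2 (logarithms) ★★ `IsTeichLog.exists_openSubgroup_gal_sub_mem` — for `M ∈ X⁰_k` and every `N` there is an open subgroup `U ≤ Γ_F` with
  **`σM − M − p^N · L_σ ∈ ξ^k B_dR⁺` for some `L_σ ∈ X⁰_k`, all `σ ∈ U`** (`log[τ y] = log[y] + p^N log[w_τ]` by `teichmuller_mul`,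
  `pow_sub_one` and uniqueness); finitely many `M_i` at once (`exists_openSubgroup_gal_sub_mem_forall`).
* §3 (scalars) `IsTeichLog.exists_eq_pow_mul_of_norm_le` — `‖c‖ ≤ p^{-N}` ⟹ `c · Y = p^N · Y'` with `Y' ∈ X⁰_k`; for a continuous
  `c : Γ_F → ℤ_p` with `c(1) = 0` this holds for `σ` near `1` (`eventually_exists_eq_pow_mul`).

Use (line `kato_lever` of crux K★ `stmt-BirchSwinnertonDyer-22226`, (H4) step (3)): the `X⁰₂`-valued error cochain of the recognition
(`Σ_i η_i(σ) X_i − ψ(σ) L_ũ − (σM − M)`, memo `Lines/kato-lever-K3-legendre.md`) lies in `p^N X⁰₂ + Fil²` for `σ` near `1`, so the correction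
cochain `h` of `BdRPlusLogTeichKernelUniform.exists_periodLine_sub_mem_sq_of_isTeichLog` is `p^N`-divisible near `1` — its continuity.
Infrastructure only; BSD / K★ / [REC] are NOT proved by any of this.

## References
* J.-M. Fontaine, *Le corps des périodes p-adiques*, Astérisque 223 (1994), Exp. II §1.3–1.5 (continuity of the action, `R` perfect).
  [FontaineAsterisque223III]
* K. Kato, LNM 1553 (1993), Ch. II §1.2.5 (the topology on `B_dR⁺/Fil^n`). [Kato1993LNM1553]
* J.-M. Fontaine, Y. Ouyang, *Theory of p-adic Galois representations*, §4.3–4.4, §6.1. [FontaineOuyang2022]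
-/

noncomputable section

namespace Literature.NumberTheory.PAdicHodge

namespace GaloisContinuity

open ValuativeRel Field Ideal WittVector Topology Filter
open Literature.NumberTheory.GaloisRepresentations Literature.NumberTheory.GaloisRepresentations.IsNonarchimedeanLocalField

variable {F : Type} [Field F] [ValuativeRel F] [TopologicalSpace F] [IsNonarchimedeanLocalField F]
  [CharZero F] {p : ℕ} [Fact p.Prime] [Fact (¬ IsUnit (p : integerC F))]
  [IsAdicComplete (Ideal.span {(p : integerC F)}) (integerC F)]

/-! ## §1 The tilt: `τ y = y · w^{p^N}` with `w₀ = 1` on an open subgroup -/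

omit [CharZero F] [IsAdicComplete (Ideal.span {(p : integerC F)}) (integerC F)] in
/-- **Perfectness**: if the coefficients `z_0, …, z_N` of `z ∈ 𝒪_{ℂ_F}♭` in `𝒪_{ℂ_F}/p` are all `1`, then `z = w^{p^N}` for the
`p^N`-th root `w = φ^{-N} z`, whose `0`-th coefficient is `z_N = 1`. [cite: FontaineAsterisque223III, Exp. II §1.2.2] [cite: FontaineOuyang2022, §4.3] -/
theorem tilt_exists_pow_eq_of_forall_coeff_eq_one (z : PreTilt (integerC F) p) (N : ℕ)
    (hz : ∀ n ≤ N, PreTilt.coeff n z = 1) : ∃ w : PreTilt (integerC F) p, PreTilt.coeff 0 w = 1 ∧ w ^ p ^ N = z := by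
  refine ⟨((frobeniusEquiv (PreTilt (integerC F) p) p).symm^[N]) z, ?_, iterate_frobeniusEquiv_symm_pow_p_pow _ p z N⟩
  rw [PreTilt.coeff_iterate_frobeniusEquiv_symm, zero_add]
  exact hz N le_rfl

omit [CharZero F] [IsAdicComplete (Ideal.span {(p : integerC F)}) (integerC F)] in
/-- The coefficients of `y` with `y₀ = 1` are units of `𝒪_{ℂ_F}/p` (`y_n^{pⁿ} = y₀ = 1`). [cite: FontaineOuyang2022, §4.3] -/
theorem tilt_isUnit_coeff_of_coeff_zero_eq_one {y : PreTilt (integerC F) p} (hy : PreTilt.coeff 0 y = 1) (n : ℕ) :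
    IsUnit (PreTilt.coeff n y) :=
  IsUnit.of_pow_eq_one (PreTilt.coeff_pow_prime_pow_eq_one hy n) (pow_ne_zero n (Fact.out : p.Prime).ne_zero)

omit [IsAdicComplete (Ideal.span {(p : integerC F)}) (integerC F)] in
/-- For `y ∈ 𝒪_{ℂ_F}♭` and `N`, the coefficients `(τ y)_n = y_n` for all `n ≤ N` and all `τ` in an open subgroup of `Γ_F` (one open
subgroup for the finitely many `n`, `AinfGaloisContinuity.exists_openSubgroup_coeff_galTilt_eq`). [cite: FontaineAsterisque223III, Exp. II §1.3] -/
theorem exists_openSubgroup_forall_le_coeff_galTilt_eq (y : PreTilt (integerC F) p) (N : ℕ) :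
    ∃ U : OpenSubgroup (absoluteGaloisGroup F), ∀ τ ∈ U, ∀ n ≤ N, PreTilt.coeff n (galTilt τ y) = PreTilt.coeff n y := by
  classical
  have hp0 : (p : CompletedAlgClosure F) ≠ 0 := natCast_C_ne_zero (Fact.out : p.Prime).ne_zero
  choose U hU using fun n : Fin (N + 1) => exists_openSubgroup_coeff_galTilt_eq hp0 y (n : ℕ)
  refine ⟨Finset.univ.inf U, fun τ hτ n hn => ?_⟩
  have h := hU ⟨n, Nat.lt_succ_of_le hn⟩ τ ((Finset.inf_le (Finset.mem_univ _) : Finset.univ.inf U ≤ U ⟨n, _⟩) hτ)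
  exact h

omit [IsAdicComplete (Ideal.span {(p : integerC F)}) (integerC F)] in
/-- ★ **`τ y = y · w_τ^{p^N}` near `1`.** For `y ∈ 𝒪_{ℂ_F}♭` with `y₀ = 1` and every `N` there is an open subgroup `U ≤ Γ_F` such that for
`τ ∈ U`: **`τ y = y · w^{p^N}` for some `w` with `w₀ = 1`** (`z = τ y · y^{(-1)}` has `z_n = 1` for `n ≤ N` since `(τ y)_n = y_n` is a unit;
then §1). [cite: FontaineAsterisque223III, Exp. II §1.3] [cite: FontaineOuyang2022, §4.3] -/
theorem exists_openSubgroup_galTilt_eq_mul_pow {y : PreTilt (integerC F) p} (hy : PreTilt.coeff 0 y = 1) (N : ℕ) :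
    ∃ U : OpenSubgroup (absoluteGaloisGroup F), ∀ τ ∈ U,
      ∃ w : PreTilt (integerC F) p, PreTilt.coeff 0 w = 1 ∧ galTilt τ y = y * w ^ p ^ N := by
  obtain ⟨U, hU⟩ := exists_openSubgroup_forall_le_coeff_galTilt_eq y N
  refine ⟨U, fun τ hτ => ?_⟩
  -- `z = τ y · y⁻¹`
  set z : PreTilt (integerC F) p := galTilt τ y * PreTilt.tiltPow y (-1) with hzdef
  have hinv : y * PreTilt.tiltPow y (-1) = 1 := by
    have h := PreTilt.tiltPow_add y 1 (-1)
    rw [add_neg_cancel, PreTilt.tiltPow_zero, PreTilt.tiltPow_one hy] at h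
    exact h.symm
  have hyz : y * z = galTilt τ y := by
    rw [hzdef, mul_left_comm, hinv, mul_one]
  have hz : ∀ n ≤ N, PreTilt.coeff n z = 1 := fun n hn => by
    have h1 : PreTilt.coeff n y * PreTilt.coeff n z = PreTilt.coeff n y * 1 := by
      rw [← map_mul, hyz, hU τ hτ n hn, mul_one]
    exact (tilt_isUnit_coeff_of_coeff_zero_eq_one hy n).mul_right_injective h1
  obtain ⟨w, hw0, hw⟩ := tilt_exists_pow_eq_of_forall_coeff_eq_one z N hz
  exact ⟨w, hw0, by rw [hw, hyz]⟩

/-! ## §2 Logarithms: `σM − M ∈ p^N X⁰_k + Fil^k` on an open subgroup -/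

/-- ★ **Generator form.** If `L` is a logarithm of `[y]` modulo `Fil^k` (`y₀ = 1`) then for every `N` there is an open subgroup `U ≤ Γ_F`
such that for `τ ∈ U`: **`τL − L − p^N · L' ∈ ξ^k B_dR⁺` for a Teichmüller logarithm `L'`** (`τ y = y w^{p^N}`, and `L + p^N log[w]`,
`τ L` are two logarithms of `[τ y]`). [cite: FontaineAsterisque223III, Exp. II §1.3–1.5] [cite: Kato1993LNM1553, Ch. II §1.2.5] -/
theorem IsLogModFil.exists_openSubgroup_gal_sub_mem {k : ℕ} {y : PreTilt (integerC F) p} (hy : PreTilt.coeff 0 y = 1)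
    {L : BDeRhamPlus (integerC F) p} (hL : IsLogModFil k ((teichmuller p y : Ainf (p := p) F) - 1) L) (N : ℕ) :
    ∃ U : OpenSubgroup (absoluteGaloisGroup F), ∀ τ ∈ U, ∃ L' : BDeRhamPlus (integerC F) p,
      IsTeichLog k L' ∧ PAdicHodge.galBdRPlus τ L - L - (p : BDeRhamPlus (integerC F) p) ^ N * L' ∈
        Ideal.span {(xiBdR : BDeRhamPlus (integerC F) p) ^ k} := by
  obtain ⟨U, hU⟩ := exists_openSubgroup_galTilt_eq_mul_pow hy N
  refine ⟨U, fun τ hτ => ?_⟩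
  obtain ⟨w, hw0, hw⟩ := hU τ hτ
  have hwI := (teichmuller_sub_one_mem_span_p_xi_iff_coeff_zero w).2 hw0
  obtain ⟨Lw, hLw⟩ := GaloisContinuity.exists_isLogModFil hwI k
  -- `p^N · Lw` is a logarithm of `[w^{p^N}]`
  have hpow := hLw.pow_sub_one hwI (p ^ N)
  rw [add_sub_cancel, ← map_pow, nsmul_eq_mul, Nat.cast_pow] at hpow
  have hwN0 : PreTilt.coeff 0 (w ^ p ^ N) = 1 := by rw [map_pow, hw0, one_pow]
  -- `L + p^N Lw` and `τ L` are logarithms of `[τ y]`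
  have hsum := hL.teichmuller_mul hy hwN0 hpow
  rw [← hw] at hsum
  have hτ' := hL.galBdRPlus τ
  rw [map_sub, map_one, galAinf_teichmuller] at hτ'
  refine ⟨Lw, ⟨w, hw0, hLw⟩, ?_⟩
  have h := hτ'.sub_mem_span_xiBdR_pow hsum
  rwa [← sub_sub] at h

/-- ★★ **`p`-adic continuity of `Γ_F` on `X⁰_k`.** For a Teichmüller logarithm `M ∈ X⁰_k` and every `N` there is an open subgroup
`U ≤ Γ_F` such that **`σM − M − p^N · L_σ ∈ ξ^k B_dR⁺` with `L_σ ∈ X⁰_k`** for all `σ ∈ U`: the map `σ ↦ σM` is continuous from the Krull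
topology to the `p`-adic structure `(p^N X⁰_k + Fil^k)_N` of `X⁰_k`. [cite: FontaineAsterisque223III, Exp. II §1.3–1.5]
[cite: Kato1993LNM1553, Ch. II §1.2.5] -/
theorem IsTeichLog.exists_openSubgroup_gal_sub_mem {k : ℕ} {M : BDeRhamPlus (integerC F) p} (hM : IsTeichLog k M) (N : ℕ) :
    ∃ U : OpenSubgroup (absoluteGaloisGroup F), ∀ σ ∈ U, ∃ L' : BDeRhamPlus (integerC F) p,
      IsTeichLog k L' ∧ PAdicHodge.galBdRPlus σ M - M - (p : BDeRhamPlus (integerC F) p) ^ N * L' ∈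
        Ideal.span {(xiBdR : BDeRhamPlus (integerC F) p) ^ k} := by
  obtain ⟨y, hy, h⟩ := hM
  exact h.exists_openSubgroup_gal_sub_mem hy N

/-- **Finitely many at once**: for `M_1, …, M_m ∈ X⁰_k` one open subgroup serves all of them.
[cite: FontaineAsterisque223III, Exp. II §1.3–1.5] -/
theorem exists_openSubgroup_gal_sub_mem_forall {k m : ℕ} {M : Fin m → BDeRhamPlus (integerC F) p}
    (hM : ∀ i, IsTeichLog k (M i)) (N : ℕ) :
    ∃ U : OpenSubgroup (absoluteGaloisGroup F), ∀ σ ∈ U, ∀ i, ∃ L' : BDeRhamPlus (integerC F) p,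
      IsTeichLog k L' ∧ PAdicHodge.galBdRPlus σ (M i) - M i - (p : BDeRhamPlus (integerC F) p) ^ N * L' ∈
        Ideal.span {(xiBdR : BDeRhamPlus (integerC F) p) ^ k} := by
  classical
  choose U hU using fun i => IsTeichLog.exists_openSubgroup_gal_sub_mem (hM i) N
  refine ⟨Finset.univ.inf U, fun σ hσ i => hU i σ ?_⟩
  exact (Finset.inf_le (Finset.mem_univ i) : Finset.univ.inf U ≤ U i) hσ

/-! ## §3 Scalars: `p^N`-divisible coefficients -/

/-- **`c · Y = p^N · Y'` with `Y' ∈ X⁰_k` when `‖c‖ ≤ p^{-N}`** (`c = p^N c'`, `Y' = c' · Y`). [cite: FontaineOuyang2022, §6.1] -/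
theorem IsTeichLog.exists_eq_pow_mul_of_norm_le {k : ℕ} {Y : BDeRhamPlus (integerC F) p} (hY : IsTeichLog k Y) {c : ℤ_[p]} {N : ℕ}
    (hc : ‖c‖ ≤ (p : ℝ) ^ (-(N : ℤ))) :
    ∃ Y' : BDeRhamPlus (integerC F) p, IsTeichLog k Y' ∧ qpToBdR (c : ℚ_[p]) * Y = (p : BDeRhamPlus (integerC F) p) ^ N * Y' := by
  rw [PadicInt.norm_le_pow_iff_mem_span_pow, Ideal.mem_span_singleton'] at hc
  obtain ⟨c', rfl⟩ := hc
  refine ⟨qpToBdR (c' : ℚ_[p]) * Y, hY.padicInt_smul c', ?_⟩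
  rw [PadicInt.coe_mul, PadicInt.coe_pow, PadicInt.coe_natCast, map_mul, map_pow, map_natCast]
  ring

/-- **Near `1`, a continuous coefficient is `p^N`-divisible**: for a continuous `c : Γ_F → ℤ_p` with `c(1) = 0` and `Y ∈ X⁰_k`,
`c(σ) · Y = p^N · Y'_σ` with `Y'_σ ∈ X⁰_k` for all `σ` in a neighbourhood of `1`. [cite: FontaineOuyang2022, §6.1]
[cite: Kato1993LNM1553, Ch. II §1.2.5] -/
theorem IsTeichLog.eventually_exists_eq_pow_mul {k : ℕ} {Y : BDeRhamPlus (integerC F) p} (hY : IsTeichLog k Y)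
    {c : absoluteGaloisGroup F → ℤ_[p]} (hc : Continuous c) (hc1 : c 1 = 0) (N : ℕ) :
    ∀ᶠ σ in 𝓝 (1 : absoluteGaloisGroup F), ∃ Y' : BDeRhamPlus (integerC F) p,
      IsTeichLog k Y' ∧ qpToBdR (c σ : ℚ_[p]) * Y = (p : BDeRhamPlus (integerC F) p) ^ N * Y' := by
  have hpos : (0 : ℝ) < (p : ℝ) ^ (-(N : ℤ)) := zpow_pos (by exact_mod_cast (Fact.out : p.Prime).pos) _
  have hev : ∀ᶠ σ in 𝓝 (1 : absoluteGaloisGroup F), ‖c σ‖ ≤ (p : ℝ) ^ (-(N : ℤ)) := by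
    have h := (hc.tendsto 1).eventually (Metric.closedBall_mem_nhds (c 1) hpos)
    refine h.mono fun σ hσ => ?_
    have hσ' : dist (c σ) (c 1) ≤ (p : ℝ) ^ (-(N : ℤ)) := hσ
    rwa [hc1, dist_zero_right] at hσ'
  exact hev.mono fun σ hσ => hY.exists_eq_pow_mul_of_norm_le hσ

end GaloisContinuity

end Literature.NumberTheory.PAdicHodge

end
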